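import Summits.NavierStokesRegularity.NavierStokesRegularity.Theses.TerminalTrace

/-!
# The log ceiling for local `L³` concentration in the Type-I / weak-`L³` class (nsreg-p2 g29, ROUND-30)

Layer-cake bookkeeping behind ROUND-30 «the log ceiling».  If `h³ · |{|g| > h}| ≤ M³` for all
`h > 0` (weak-`L³` bound) and `|g| ≤ L` a.e. on a set `S` of finite measure, then for every
`0 < h₀ ≤ L`

  `∫_S |g|³ ≤ |S| · h₀³ + 3 M³ · log (L / h₀)`.

With `S = B(x₀,R)`, `L = C/√(T−t)` (Type I in time) and `h₀ = M |B_R|^{-1/3}` this is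
`∫_{B(x₀,R)} |u(t)|³ ≤ M³ + 3M³ log (C |B_R|^{1/3} / (M √(T−t)))`: on the Barker–Prange balls
`R = √T (T−t)^{(1−δ)/2}` the local `L³` mass of ANY Type-I / weak-`L³` blow-up is at most
`3M³ · (δ/2) · log (1/(T−t)) + O_{M,C,T}(1)` — the same `log` as the Barker–Prange 2021 Thm 1 floor
`(δ/2) log(1/(T−t)) / exp exp (M^{1025})`, so the printed rate is optimal for every Type-I blow-up (not
only for DSS, their Cor. 1) and the whole quantitative content sits in the ratio of the two constants.
Pure measure theory; no Navier–Stokes input. [folklore]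
-/

set_option linter.dupNamespace false

open MeasureTheory Set Filter Topology Metric
open scoped ENNReal NNReal
open Literature.Analysis.FluidPDE

namespace Summit.NavierStokesRegularity.NavierStokesRegularity.Theorems.TypeITraceScarL3

/-- **Layer-cake log ceiling.**  A weak-`L³` function bounded by `L` on a set `S` has
`∫_S |g|³ ≤ |S| h₀³ + 3M³ log(L/h₀)` for every `0 < h₀ ≤ L`. [folklore] -/
theorem setLIntegral_cube_le_of_weakL3 {α : Type*} [MeasurableSpace α] {μ : Measure α}
    {E : Type*} [NormedAddCommGroup E] (g : α → E) (S : Set α)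
    (hg : AEStronglyMeasurable g (μ.restrict S)) (M L h₀ : ℝ) (hM : 0 ≤ M) (hh₀ : 0 < h₀)
    (hhL : h₀ ≤ L)
    (hweak : ∀ h : ℝ, 0 < h → ENNReal.ofReal (h ^ 3) * μ {x | h < ‖g x‖} ≤ ENNReal.ofReal (M ^ 3))
    (hbound : ∀ᵐ x ∂(μ.restrict S), ‖g x‖ ≤ L) :
    ∫⁻ x in S, ENNReal.ofReal (‖g x‖ ^ (3 : ℝ)) ∂μ ≤
      μ S * ENNReal.ofReal (h₀ ^ 3) + ENNReal.ofReal (3 * M ^ 3 * Real.log (L / h₀)) := by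
  have hL : 0 < L := hh₀.trans_le hhL
  -- layer cake
  rw [lintegral_rpow_eq_lintegral_meas_lt_mul (μ.restrict S)
    (Eventually.of_forall fun _ => norm_nonneg _) hg.norm.aemeasurable (by norm_num : (0:ℝ) < 3)]
  set Φ : ℝ → ℝ≥0∞ := fun t => (μ.restrict S) {a | t < ‖g a‖} * ENNReal.ofReal (t ^ ((3:ℝ) - 1))
    with hΦ_def
  have hΦ2 : ∀ t : ℝ, Φ t = (μ.restrict S) {a | t < ‖g a‖} * ENNReal.ofReal (t ^ 2) := by
    intro t
    rw [hΦ_def]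
    simp only
    rw [show ((3:ℝ) - 1) = 2 by norm_num, Real.rpow_two]
  -- piece 1 : `t ∈ (0, h₀]`
  have hP1 : ∫⁻ t in Ioc 0 h₀, Φ t ≤ μ S * ENNReal.ofReal (h₀ ^ 3 / 3) := by
    have hpt : ∀ t ∈ Ioc 0 h₀, Φ t ≤ μ S * ENNReal.ofReal (t ^ 2) := by
      intro t _
      rw [hΦ2]
      refine mul_le_mul' ?_ le_rfl
      calc (μ.restrict S) {a | t < ‖g a‖} ≤ (μ.restrict S) univ := measure_mono (subset_univ _)
        _ = μ S := Measure.restrict_apply_univ S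
    have hint : IntegrableOn (fun t : ℝ => t ^ 2) (Ioc 0 h₀) volume :=
      ((continuous_pow 2).continuousOn.integrableOn_Icc).mono_set Ioc_subset_Icc_self
    calc ∫⁻ t in Ioc 0 h₀, Φ t ≤ ∫⁻ t in Ioc 0 h₀, μ S * ENNReal.ofReal (t ^ 2) :=
          setLIntegral_mono' measurableSet_Ioc hpt
      _ = μ S * ∫⁻ t in Ioc 0 h₀, ENNReal.ofReal (t ^ 2) :=
          lintegral_const_mul _ (ENNReal.measurable_ofReal.comp (measurable_id.pow_const 2))
      _ = μ S * ENNReal.ofReal (h₀ ^ 3 / 3) := by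
          rw [← ofReal_integral_eq_lintegral_ofReal hint (Eventually.of_forall fun t => sq_nonneg t),
            ← intervalIntegral.integral_of_le hh₀.le, integral_pow]
          norm_num
  -- piece 2 : `t ∈ (h₀, L]`
  have hP2 : ∫⁻ t in Ioc h₀ L, Φ t ≤ ENNReal.ofReal (M ^ 3 * Real.log (L / h₀)) := by
    have hpt : ∀ t ∈ Ioc h₀ L, Φ t ≤ ENNReal.ofReal (M ^ 3 / t) := by
      intro t ht
      have ht0 : 0 < t := hh₀.trans ht.1
      rw [hΦ2]
      have h1 : (μ.restrict S) {a | t < ‖g a‖} ≤ μ {a | t < ‖g a‖} :=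
        Measure.le_iff'.1 Measure.restrict_le_self _
      have h2 : μ {a | t < ‖g a‖} ≤ ENNReal.ofReal (M ^ 3) / ENNReal.ofReal (t ^ 3) := by
        rw [ENNReal.le_div_iff_mul_le (Or.inl (by
            rw [ne_eq, ENNReal.ofReal_eq_zero, not_le]; positivity))
          (Or.inl ENNReal.ofReal_ne_top), mul_comm]
        exact hweak t ht0
      calc (μ.restrict S) {a | t < ‖g a‖} * ENNReal.ofReal (t ^ 2)
          ≤ (ENNReal.ofReal (M ^ 3) / ENNReal.ofReal (t ^ 3)) * ENNReal.ofReal (t ^ 2) := by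
            gcongr
            exact h1.trans h2
        _ = ENNReal.ofReal (M ^ 3 / t) := by
            rw [← ENNReal.ofReal_div_of_pos (by positivity), ← ENNReal.ofReal_mul (by positivity)]
            congr 1
            field_simp
    have hint : IntegrableOn (fun t : ℝ => M ^ 3 / t) (Ioc h₀ L) volume := by
      refine (ContinuousOn.integrableOn_Icc ?_).mono_set Ioc_subset_Icc_self
      exact continuousOn_const.div continuousOn_id fun x hx => (hh₀.trans_le hx.1).ne'
    have hnn : 0 ≤ᵐ[volume.restrict (Ioc h₀ L)] fun t : ℝ => M ^ 3 / t := by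
      filter_upwards [ae_restrict_mem measurableSet_Ioc] with t ht
      exact div_nonneg (pow_nonneg hM 3) (hh₀.trans ht.1).le
    calc ∫⁻ t in Ioc h₀ L, Φ t ≤ ∫⁻ t in Ioc h₀ L, ENNReal.ofReal (M ^ 3 / t) :=
          setLIntegral_mono' measurableSet_Ioc hpt
      _ = ENNReal.ofReal (∫ t in Ioc h₀ L, M ^ 3 / t) :=
          (ofReal_integral_eq_lintegral_ofReal hint hnn).symm
      _ = ENNReal.ofReal (M ^ 3 * Real.log (L / h₀)) := by
          rw [← intervalIntegral.integral_of_le hhL]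
          have : (∫ t in h₀..L, M ^ 3 / t) = M ^ 3 * Real.log (L / h₀) := by
            rw [show (∫ t in h₀..L, M ^ 3 / t) = ∫ t in h₀..L, M ^ 3 * t⁻¹ by
              simp_rw [div_eq_mul_inv], intervalIntegral.integral_const_mul,
              integral_inv_of_pos hh₀ hL]
          rw [this]
  -- piece 3 : `t > L` carries nothing
  have hP3 : ∫⁻ t in Ioi L, Φ t = 0 := by
    refine (setLIntegral_congr_fun measurableSet_Ioi (fun t ht => ?_)).trans lintegral_zero
    have hz : (μ.restrict S) {a | t < ‖g a‖} = 0 := by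
      have := ae_iff.1 (hbound.mono fun x hx => (hx.trans (le_of_lt ht) : ‖g x‖ ≤ t))
      simpa [not_le] using this
    rw [hΦ2, hz, zero_mul]
  -- assemble
  have hsplit : ∫⁻ t in Ioi 0, Φ t ≤
      (∫⁻ t in Ioc 0 h₀, Φ t) + (∫⁻ t in Ioc h₀ L, Φ t) + ∫⁻ t in Ioi L, Φ t := by
    have hsub : Ioi (0:ℝ) ⊆ (Ioc 0 h₀ ∪ Ioc h₀ L) ∪ Ioi L := by
      intro t ht
      simp only [mem_Ioi] at ht
      simp only [mem_union, mem_Ioc, mem_Ioi]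
      rcases le_or_gt t h₀ with h | h
      · exact Or.inl (Or.inl ⟨ht, h⟩)
      · rcases le_or_gt t L with h' | h'
        · exact Or.inl (Or.inr ⟨h, h'⟩)
        · exact Or.inr h'
    calc ∫⁻ t in Ioi 0, Φ t ≤ ∫⁻ t in (Ioc 0 h₀ ∪ Ioc h₀ L) ∪ Ioi L, Φ t :=
          lintegral_mono_set hsub
      _ ≤ (∫⁻ t in Ioc 0 h₀ ∪ Ioc h₀ L, Φ t) + ∫⁻ t in Ioi L, Φ t := lintegral_union_le _ _ _
      _ ≤ (∫⁻ t in Ioc 0 h₀, Φ t) + (∫⁻ t in Ioc h₀ L, Φ t) + ∫⁻ t in Ioi L, Φ t := by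
          gcongr
          exact lintegral_union_le _ _ _
  calc ENNReal.ofReal 3 * ∫⁻ t in Ioi 0, Φ t
      ≤ ENNReal.ofReal 3 * (μ S * ENNReal.ofReal (h₀ ^ 3 / 3) +
          ENNReal.ofReal (M ^ 3 * Real.log (L / h₀)) + 0) := by
        gcongr
        calc ∫⁻ t in Ioi 0, Φ t ≤ _ := hsplit
          _ ≤ _ := by rw [hP3]; gcongr
    _ = μ S * ENNReal.ofReal (h₀ ^ 3) + ENNReal.ofReal (3 * M ^ 3 * Real.log (L / h₀)) := by
        rw [add_zero, mul_add, mul_left_comm, ← ENNReal.ofReal_mul (by norm_num : (0:ℝ) ≤ 3),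
          ← ENNReal.ofReal_mul (by norm_num : (0:ℝ) ≤ 3)]
        congr 2
        · field_simp
        · ring

/-- **The log ceiling for a Type-I / weak-`L³` slice.**  If `|u(t,x)| ≤ C/√(T−t)` on `B(x₀,R)` and
`h³|{|u(t)| > h}| ≤ M³`, then for every `0 < h₀ ≤ C/√(T−t)`:
`∫_{B(x₀,R)} |u(t)|³ ≤ |B_R| h₀³ + 3M³ log (C / (h₀ √(T−t)))`.  (Take `h₀ = M|B_R|^{-1/3}`.)
[folklore] -/
theorem typeI_weakL3_local_L3_log_ceiling
    (u : ℝ → EuclideanSpace ℝ (Fin 3) → EuclideanSpace ℝ (Fin 3)) (t T C M R h₀ : ℝ)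
    (x₀ : EuclideanSpace ℝ (Fin 3)) (htT : t < T) (hM : 0 ≤ M) (hh₀ : 0 < h₀)
    (hh₀C : h₀ ≤ C / Real.sqrt (T - t))
    (hmeas : AEStronglyMeasurable (u t) (volume.restrict (ball x₀ R)))
    (hrate : ∀ x ∈ ball x₀ R, ‖u t x‖ ≤ C / Real.sqrt (T - t))
    (hweak : ∀ h : ℝ, 0 < h →
      ENNReal.ofReal (h ^ 3) * volume {x | h < ‖u t x‖} ≤ ENNReal.ofReal (M ^ 3)) :
    ∫⁻ x in ball x₀ R, ENNReal.ofReal (‖u t x‖ ^ (3 : ℝ)) ≤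
      volume (ball x₀ R) * ENNReal.ofReal (h₀ ^ 3) +
        ENNReal.ofReal (3 * M ^ 3 * Real.log (C / Real.sqrt (T - t) / h₀)) := by
  have _ := htT
  exact setLIntegral_cube_le_of_weakL3 (u t) (ball x₀ R) hmeas M _ h₀ hM hh₀ hh₀C hweak
    ((ae_restrict_mem measurableSet_ball).mono fun x hx => hrate x hx)

end Summit.NavierStokesRegularity.NavierStokesRegularity.Theorems.TypeITraceScarL3
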